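import Summits.ValiantsHypothesis.ValiantsHypothesis.Theorems.KPlusLogSqLawWindowDescartesDefs

/-!
# Window Descartes rule — part 1: sign changes of finite real sequences

Lemmas about `firstNZ` / `sgnChanges` / `slist` of `…WindowDescartesDefs` (seat val-sym-lift-p4 (g2); the window
Descartes rule is GAP-LIFT §7, the «window localisation» technique named in the docstring of the plan-only rung
`stub_weakLiftRungEdge` of the `WeakLifting` skeleton, stmt-ValiantsHypothesis-19561): invariance of the number of sign
changes under reversal (`sgnChanges_reverse`) and under deleting zeros, dependence on the signs only (`sgnChanges_congr`),
constant-sign blocks (`sgnChanges_append_left/right_of_sameSign`, `sgnChanges_slist_add_of_sameSign_top`), splitting and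
reflecting `slist`.  HONEST FRAMING: elementary combinatorics of signs; no statement of the cell is touched. [folklore]
-/

set_option linter.dupNamespace false
set_option autoImplicit false

namespace Summit.ValiantsHypothesis.ValiantsHypothesis.Theorems.KPlusLogSqLaw.WindowDescartes

open Polynomial

/-! ## 1. `firstNZ`, `sgnChanges` -/

/-- auxiliary (firstNZ cons zero). [folklore] -/
@[simp] theorem firstNZ_cons_zero (l : List ℝ) : firstNZ (0 :: l) = firstNZ l := by
  rw [firstNZ_cons, if_pos rfl]

/-- auxiliary (firstNZ cons of ne zero). [folklore] -/
theorem firstNZ_cons_of_ne_zero {x : ℝ} (hx : x ≠ 0) (l : List ℝ) : firstNZ (x :: l) = x := by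
  rw [firstNZ_cons, if_neg hx]

/-- auxiliary (sgnChanges cons zero). [folklore] -/
@[simp] theorem sgnChanges_cons_zero (l : List ℝ) : sgnChanges (0 :: l) = sgnChanges l := by
  rw [sgnChanges_cons, zero_mul, if_neg (lt_irrefl 0), add_zero]

/-- auxiliary (sgnChanges singleton). [folklore] -/
@[simp] theorem sgnChanges_singleton (x : ℝ) : sgnChanges [x] = 0 := by
  rw [sgnChanges_cons, sgnChanges_nil, firstNZ_nil, mul_zero, if_neg (lt_irrefl 0)]

/-- auxiliary (firstNZ eq zero iff). [folklore] -/
theorem firstNZ_eq_zero_iff {l : List ℝ} : firstNZ l = 0 ↔ ∀ y ∈ l, y = 0 := by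
  induction l with
  | nil => simp
  | cons x l ih =>
    rw [firstNZ_cons]
    by_cases hx : x = 0
    · simp [hx, ih]
    · simp [hx]

/-- auxiliary (firstNZ mem of ne zero). [folklore] -/
theorem firstNZ_mem_of_ne_zero {l : List ℝ} (h : firstNZ l ≠ 0) : firstNZ l ∈ l := by
  induction l with
  | nil => exact absurd rfl h
  | cons x l ih =>
    rw [firstNZ_cons] at h ⊢
    by_cases hx : x = 0
    · rw [if_pos hx] at h ⊢; exact List.mem_cons_of_mem _ (ih h)
    · rw [if_neg hx]; exact List.mem_cons_self

/-- auxiliary (firstNZ append). [folklore] -/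
theorem firstNZ_append (l₁ l₂ : List ℝ) :
    firstNZ (l₁ ++ l₂) = if firstNZ l₁ = 0 then firstNZ l₂ else firstNZ l₁ := by
  induction l₁ with
  | nil => simp
  | cons x l ih =>
    rw [List.cons_append, firstNZ_cons, firstNZ_cons, ih]
    by_cases hx : x = 0
    · simp [hx]
    · simp [hx]

/-- auxiliary (firstNZ reverse eq zero iff). [folklore] -/
theorem firstNZ_reverse_eq_zero_iff (l : List ℝ) : firstNZ l.reverse = 0 ↔ firstNZ l = 0 := by
  rw [firstNZ_eq_zero_iff, firstNZ_eq_zero_iff]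
  constructor
  · intro h y hy; exact h y (List.mem_reverse.mpr hy)
  · intro h y hy; exact h y (List.mem_reverse.mp hy)

/-- appending one entry at the end. -/
theorem sgnChanges_append_singleton (l : List ℝ) (x : ℝ) :
    sgnChanges (l ++ [x]) = sgnChanges l + if firstNZ l.reverse * x < 0 then 1 else 0 := by
  induction l with
  | nil => simp [sgnChanges_cons]
  | cons y l ih =>
    rw [List.cons_append, sgnChanges_cons, ih, sgnChanges_cons, firstNZ_append, List.reverse_cons, firstNZ_append]
    by_cases h0 : firstNZ l = 0
    · have h0' : firstNZ l.reverse = 0 := (firstNZ_reverse_eq_zero_iff l).mpr h0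
      rw [if_pos h0, if_pos h0', h0, h0', zero_mul, mul_zero, if_neg (lt_irrefl (0:ℝ)), firstNZ_cons, firstNZ_cons,
        firstNZ_nil]
      by_cases hx : x = 0
      · rw [if_pos hx, hx]; simp
      · by_cases hy : y = 0
        · rw [if_pos hy, if_neg hx, hy]
        · rw [if_neg hy, if_neg hx, mul_comm y x]
    · have h0' : firstNZ l.reverse ≠ 0 := fun h => h0 ((firstNZ_reverse_eq_zero_iff l).mp h)
      rw [if_neg h0, if_neg h0']
      omega

/-- **the number of sign changes is invariant under reversal.** -/
theorem sgnChanges_reverse (l : List ℝ) : sgnChanges l.reverse = sgnChanges l := by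
  induction l with
  | nil => simp
  | cons x l ih =>
    rw [List.reverse_cons, sgnChanges_append_singleton, List.reverse_reverse, ih, sgnChanges_cons, mul_comm]

/-- auxiliary (firstNZ filter ne zero). [folklore] -/
theorem firstNZ_filter_ne_zero (l : List ℝ) : firstNZ (l.filter (· ≠ 0)) = firstNZ l := by
  induction l with
  | nil => simp
  | cons x l ih =>
    by_cases hx : x = 0
    · rw [hx, firstNZ_cons_zero, List.filter_cons_of_neg (by simp), ih]
    · rw [List.filter_cons_of_pos (by simpa using hx), firstNZ_cons_of_ne_zero hx, firstNZ_cons_of_ne_zero hx]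

/-- zero entries may be deleted. -/
theorem sgnChanges_filter_ne_zero (l : List ℝ) : sgnChanges (l.filter (· ≠ 0)) = sgnChanges l := by
  induction l with
  | nil => simp
  | cons x l ih =>
    by_cases hx : x = 0
    · rw [hx, sgnChanges_cons_zero, List.filter_cons_of_neg (by simp), ih]
    · rw [List.filter_cons_of_pos (by simpa using hx), sgnChanges_cons, sgnChanges_cons, ih, firstNZ_filter_ne_zero]

/-! ## 2. Dependence on signs only; constant-sign blocks -/

/-- auxiliary (mul neg iff sign). [folklore] -/
theorem mul_neg_iff_sign (x y : ℝ) : x * y < 0 ↔ SignType.sign x * SignType.sign y = -1 := by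
  rw [← sign_mul, sign_eq_neg_one_iff]

/-- auxiliary (mul pos iff sign). [folklore] -/
theorem mul_pos_iff_sign (x y : ℝ) : 0 < x * y ↔ SignType.sign x * SignType.sign y = 1 := by
  rw [← sign_mul, sign_eq_one_iff]

/-- auxiliary (sign firstNZ congr). [folklore] -/
theorem sign_firstNZ_congr {l₁ l₂ : List ℝ} (h : List.Forall₂ (fun x y => SignType.sign x = SignType.sign y) l₁ l₂) :
    SignType.sign (firstNZ l₁) = SignType.sign (firstNZ l₂) := by
  induction h with
  | nil => rfl
  | @cons x y l₁ l₂ hxy _ ih =>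
    rw [firstNZ_cons, firstNZ_cons]
    by_cases hx : x = 0
    · have hy : y = 0 := by rw [← sign_eq_zero_iff, ← hxy, sign_eq_zero_iff]; exact hx
      rw [if_pos hx, if_pos hy]; exact ih
    · have hy : y ≠ 0 := by rw [Ne, ← sign_eq_zero_iff, ← hxy, sign_eq_zero_iff]; exact hx
      rw [if_neg hx, if_neg hy]; exact hxy

/-- `sgnChanges` only depends on the signs of the entries. -/
theorem sgnChanges_congr {l₁ l₂ : List ℝ} (h : List.Forall₂ (fun x y => SignType.sign x = SignType.sign y) l₁ l₂) :
    sgnChanges l₁ = sgnChanges l₂ := by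
  induction h with
  | nil => rfl
  | @cons x y l₁ l₂ hxy hl ih =>
    rw [sgnChanges_cons, sgnChanges_cons, ih]
    have e : (x * firstNZ l₁ < 0) ↔ (y * firstNZ l₂ < 0) := by
      rw [mul_neg_iff_sign, mul_neg_iff_sign, hxy, sign_firstNZ_congr hl]
    simp only [e]

/-- auxiliary (sgnChanges map mul pos). [folklore] -/
theorem sgnChanges_map_mul_pos {κ : ℝ} (hκ : 0 < κ) (l : List ℝ) : sgnChanges (l.map (κ * ·)) = sgnChanges l := by
  refine sgnChanges_congr ?_
  induction l with
  | nil => exact List.Forall₂.nil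
  | cons x l ih => exact List.Forall₂.cons (by rw [sign_mul, sign_pos hκ, one_mul]) ih

/-- prepending an entry of the sign of the first non-zero entry (or any entry, if that one is `0`) adds no change. -/
theorem sgnChanges_cons_of_nonneg {x : ℝ} {l : List ℝ} (h : 0 ≤ x * firstNZ l) : sgnChanges (x :: l) = sgnChanges l := by
  rw [sgnChanges_cons, if_neg (not_lt.mpr h), add_zero]

/-- auxiliary (sgnChanges cons of neg). [folklore] -/
theorem sgnChanges_cons_of_neg {x : ℝ} {l : List ℝ} (h : x * firstNZ l < 0) : sgnChanges (x :: l) = sgnChanges l + 1 := by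
  rw [sgnChanges_cons, if_pos h]

/-- **prepending a block** of entries of the (strict) sign of the first non-zero entry adds no sign change. -/
theorem sgnChanges_append_left_of_sameSign (B l : List ℝ) (hl : firstNZ l ≠ 0) (hB : ∀ z ∈ B, 0 < z * firstNZ l) :
    sgnChanges (B ++ l) = sgnChanges l ∧ 0 < firstNZ (B ++ l) * firstNZ l := by
  induction B with
  | nil => exact ⟨rfl, by simpa using mul_self_pos.mpr hl⟩
  | cons z B ih =>
    have hz : 0 < z * firstNZ l := hB z List.mem_cons_self
    have ih' := ih (fun y hy => hB y (List.mem_cons_of_mem _ hy))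
    have hz0 : z ≠ 0 := by rintro rfl; simp at hz
    refine ⟨?_, ?_⟩
    · rw [List.cons_append, sgnChanges_cons_of_nonneg, ih'.1]
      -- `z` and `firstNZ (B ++ l)` both have the sign of `firstNZ l`
      have h3 : 0 < (z * firstNZ l) * (firstNZ (B ++ l) * firstNZ l) := mul_pos hz ih'.2
      nlinarith [mul_self_nonneg (firstNZ l), mul_self_pos.mpr hl]
    · rw [List.cons_append, firstNZ_cons_of_ne_zero hz0]; exact hz

/-- **appending a block** of entries of the (strict) sign of the last non-zero entry adds no sign change. -/
theorem sgnChanges_append_right_of_sameSign (l B : List ℝ) (hl : firstNZ l.reverse ≠ 0)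
    (hB : ∀ z ∈ B, 0 < z * firstNZ l.reverse) : sgnChanges (l ++ B) = sgnChanges l := by
  rw [← sgnChanges_reverse, List.reverse_append,
    (sgnChanges_append_left_of_sameSign B.reverse l.reverse hl (fun z hz => hB z (List.mem_reverse.mp hz))).1,
    sgnChanges_reverse]

/-! ## 3. Sequences: `slist c n = [c n, c (n-1), …, c 0]` -/

/-- auxiliary (length slist). [folklore] -/
theorem length_slist (c : ℕ → ℝ) (n : ℕ) : (slist c n).length = n + 1 := by
  simp [slist]

/-- auxiliary (mem slist iff). [folklore] -/
theorem mem_slist_iff {c : ℕ → ℝ} {n : ℕ} {y : ℝ} : y ∈ slist c n ↔ ∃ i, i ≤ n ∧ c i = y := by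
  simp [slist]

/-- auxiliary (slist congr). [folklore] -/
theorem slist_congr {c c' : ℕ → ℝ} {n : ℕ} (h : ∀ i, i ≤ n → c i = c' i) : slist c n = slist c' n := by
  induction n with
  | zero => simp [h 0 le_rfl]
  | succ n ih =>
    rw [slist_succ, slist_succ, h (n + 1) le_rfl, ih (fun i hi => h i (Nat.le_succ_of_le hi))]

/-- auxiliary (firstNZ slist of ne zero). [folklore] -/
theorem firstNZ_slist_of_ne_zero {c : ℕ → ℝ} {n : ℕ} (h : c n ≠ 0) : firstNZ (slist c n) = c n := by
  cases n with
  | zero => rw [slist_zero, firstNZ_cons_of_ne_zero h]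
  | succ n => rw [slist_succ, firstNZ_cons_of_ne_zero h]

/-- splitting off the top block: `slist γ (M + N + 1) = slist (k ↦ γ (M + 1 + k)) N ++ slist γ M`. -/
theorem slist_add (γ : ℕ → ℝ) (M N : ℕ) : slist γ (M + N + 1) = slist (fun k => γ (M + 1 + k)) N ++ slist γ M := by
  induction N with
  | zero => rw [Nat.add_zero, slist_succ, slist_zero]; rfl
  | succ N ih =>
    rw [show M + (N + 1) + 1 = (M + N + 1) + 1 by ring, slist_succ, ih, slist_succ, List.cons_append]
    congr 2; ring

/-- the reversed list is the list of the reflected sequence. -/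
theorem slist_reflect (c : ℕ → ℝ) (n : ℕ) : slist (fun j => c (n - j)) n = (slist c n).reverse := by
  apply List.ext_getElem
  · simp [slist]
  · intro i h₁ h₂
    simp only [slist, List.map_reverse, List.reverse_reverse, List.getElem_map, List.getElem_range,
      List.getElem_reverse, List.length_map, List.length_range]
    congr 1
    rw [length_slist] at h₁
    omega

/-- auxiliary (sgnChanges slist congr sign). [folklore] -/
theorem sgnChanges_slist_congr_sign {c c' : ℕ → ℝ} {n : ℕ} (h : ∀ i, i ≤ n → SignType.sign (c i) = SignType.sign (c' i)) :
    sgnChanges (slist c n) = sgnChanges (slist c' n) := by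
  refine sgnChanges_congr ?_
  induction n with
  | zero => exact List.Forall₂.cons (h 0 le_rfl) List.Forall₂.nil
  | succ n ih =>
    rw [slist_succ, slist_succ]
    exact List.Forall₂.cons (h _ le_rfl) (ih fun i hi => h i (Nat.le_succ_of_le hi))

/-- extending a sequence upwards by entries of the sign of the (non-zero) top entry adds no sign change. -/
theorem sgnChanges_slist_add_of_sameSign_top (γ : ℕ → ℝ) (n m : ℕ) (hn : γ n ≠ 0)
    (h : ∀ i, n < i → i ≤ n + m → 0 < γ i * γ n) : sgnChanges (slist γ (n + m)) = sgnChanges (slist γ n) := by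
  induction m with
  | zero => rfl
  | succ m ih =>
    have ih' := ih (fun i hi him => h i hi (by omega))
    rw [show n + (m + 1) = (n + m) + 1 by ring, slist_succ, sgnChanges_cons_of_nonneg, ih']
    have htop : 0 < γ (n + m + 1) * γ n := h _ (by omega) le_rfl
    rcases Nat.eq_zero_or_pos m with rfl | hm
    · show 0 ≤ γ (n + 1) * firstNZ (slist γ n)
      rw [firstNZ_slist_of_ne_zero hn]; exact htop.le
    · have hnm : 0 < γ (n + m) * γ n := h _ (by omega) (by omega)
      have hne : γ (n + m) ≠ 0 := by rintro h0; simp [h0] at hnm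
      rw [firstNZ_slist_of_ne_zero hne]
      nlinarith [mul_pos htop hnm, mul_self_nonneg (γ n)]

end Summit.ValiantsHypothesis.ValiantsHypothesis.Theorems.KPlusLogSqLaw.WindowDescartes
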